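import Summits.Ventures.LatticeQCDFlow.TrivializingMaps.EntropyFromHaar
import Summits.Ventures.LatticeQCDFlow.Scaling.EntropyBudgetMeasure

/-!
HONEST FRAMING: exact (Metropolis-corrected) sampling algorithms for lattice gauge theory; figures
of merit are autocorrelation/cost numbers at stated couplings and volumes; no continuum-physics
claim.

# FlowESSCeilingAnyGroup — EVERY EXACT FLOW SAMPLER WITH A BOUNDED MODEL DENSITY OVER THE HAAR PRIOR
# HAS `ESS ≤ C·exp(−e^{−cβ}·⌊L/2⌋^d·v_ρ·β²/2)` AT EVERY COUPLING `β ≥ 0`, FOR EVERY COMPACT GAUGE GROUP;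
# `SU(n)`: `ESS ≤ C·exp(−(c/2)·#plaq·log(1+β²))` (lean-2 GEN-10, ours)

Venture-side (OURS).  Cell `lqcd-flow` (pub-lqcd), unit `pub-lqcd-lean-2-g10`, 2026-08-23.  Theory2's
`Scaling/EntropyBudgetMeasure.wilson_essM_le` prices an exact flow sampler whose MODEL (the push-forward
of the prior) has density `0 < g ≤ C` with respect to product Haar: `ESS(μ_{Λ,β}, g·Haar^{⊗E}) ≤
C·exp(−D(μ_{Λ,β} ‖ Haar^{⊗E}))` (`essM` = Liu's asymptotic effective-sample-size fraction).  The tree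
turns this into a volume law through the entropy-growth law, i.e. for `U(1)` / `U(N)` / `SU(N)` and `β ≥ 1`
(`Scaling/EntropyBudget*`).  With GEN-10's `EntropyFromHaar` the volume law holds AT EVERY COUPLING and
FOR EVERY COMPACT GAUGE GROUP:

* **`wilson_flow_essM_le_anyGroup`** (unitary continuous `ρ`, `d ≥ 2`, `L ≥ 2`, `β ≥ 0`, model density
  `0 < g ≤ C` measurable): `ESS ≤ C·exp(−e^{−βc}·⌊L/2⌋^d·Var_Haar(Re tr ρ)·β²/2)`, `c = 2NK(1+4K)`,
  `K = (d+1)d²` — EXPONENTIALLY SMALL IN THE VOLUME at every `β > 0` whenever `Var_Haar(Re tr ρ) > 0`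
  (T4 `VolumeScalingOfTraining` / `ExactnessVsExpressivity`, capacity half, every compact `G`, no
  expansion, no one-plaquette input);
* **`wilson_flow_essM_le_sun`** (`SU(n)`, `n ≥ 2`, `d ≥ 2`): one `c = c(n,d) > 0` with
  `ESS ≤ C·exp(−(c/2)·#plaq·log(1+β²))` for every `β ≥ 0`, every `L ≥ 2`, every model density `0 < g ≤ C`.

NOT CLAIMED: anything about a specific architecture or its training; the constants (theory2's `c` and
GEN-9's `e^{−βc}` are astronomically poor — structural laws); finite-sample ESS; the continuum.  Literature
grade (cell rule): corollary; new typing.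
-/

noncomputable section

open MeasureTheory ProbabilityTheory InformationTheory
open Literature.MathematicalPhysics.QuantumFieldTheory
open Literature.MathematicalPhysics.QuantumFieldTheory.Luscher2010
open Summit.Ventures.LatticeQCDFlow.Theory2 (essM)
open scoped Matrix Matrix.Norms.Frobenius ContDiff

namespace Summit.Ventures.LatticeQCDFlow.TrivializingMaps

section AnyGroup

variable {d L N : ℕ} [NeZero L] {G : Type*} [Group G] [TopologicalSpace G] [IsTopologicalGroup G]
  [CompactSpace G] [MeasurableSpace G] [BorelSpace G] [SecondCountableTopology G]
  (ρ : G →* Matrix (Fin N) (Fin N) ℂ)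

/-- **ESS CEILING FOR EXACT FLOW SAMPLERS, EVERY COMPACT GAUGE GROUP, EVERY COUPLING**: for unitary
continuous `ρ`, `d ≥ 2`, `L ≥ 2`, `β ≥ 0` and every measurable model density `0 < g ≤ C` over product
Haar, `ESS(μ_β, g·Haar^{⊗E}) ≤ C·exp(−e^{−βc}·⌊L/2⌋^d·Var_Haar(Re tr ρ)·β²/2)`. [ours] -/
theorem wilson_flow_essM_le_anyGroup (hd : 2 ≤ d) (hL : 2 ≤ L) (hρ : Continuous ρ)
    (hρu : ∀ g, ρ g ∈ Matrix.unitaryGroup (Fin N) ℂ) {β : ℝ} (hβ : 0 ≤ β)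
    {g : GaugeConfig d L G → ℝ} (hg : Measurable g) {C : ℝ} (hg0 : ∀ U, 0 < g U) (hgC : ∀ U, g U ≤ C) :
    essM (wilsonMeasure (d := d) (L := L) ρ β)
        ((Measure.pi fun _ : Edge d L => haarProbability G).withDensity fun U => ENNReal.ofReal (g U)) ≤
      C * Real.exp (-(Real.exp (-(β * (2 * N * ((d + 1) * d ^ 2 : ℕ) * (1 + 4 * ((d + 1) * d ^ 2 : ℕ))))) *
          ((L / 2) ^ d : ℕ) * variance (fun g => (ρ g).trace.re) (haarProbability G) * β ^ 2 / 2)) := by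
  -- `Re tr ρ ≤ N` (Literature `abs_re_trace_le_card`; not restated — a tree lemma has the same statement)
  have htr : ∀ x : G, (ρ x).trace.re ≤ N := fun x => by
    have h := Literature.RepresentationTheory.CompactGroups.CompactGroup.abs_re_trace_le_card ρ hρ x
    rw [Fintype.card_fin] at h
    exact (abs_le.1 h).2
  have h1 := Theory2.Lattice.wilson_essM_le (d := d) (L := L) ρ hρ htr hβ hg hg0 hgC
  refine h1.trans ?_
  have hC : 0 ≤ C := (hg0 (fun _ => 1)).le.trans (hgC _)
  refine mul_le_mul_of_nonneg_left (Real.exp_le_exp.2 (neg_le_neg ?_)) hC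
  have h2 := klDiv_haar_ge_anyGroup (d := d) (L := L) ρ hd hL hρ hρu hβ
  simpa only [trivialMeasure] using h2

end AnyGroup

section SUN

variable {d n : ℕ}

/-- **ESS CEILING FOR EXACT FLOW SAMPLERS, `SU(n)`**: for `n ≥ 2`, `d ≥ 2` there is `c = c(n,d) > 0`
such that for every `L ≥ 2`, every `β ≥ 0` and every measurable model density `0 < g ≤ C` over product
Haar, `ESS(μ_β, g·Haar^{⊗E}) ≤ C·exp(−(c/2)·#plaq·log(1+β²))`. [ours] -/
theorem wilson_flow_essM_le_sun (hn : 2 ≤ n) (hd : 2 ≤ d) :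
    ∃ c : ℝ, 0 < c ∧ ∀ (L : ℕ) [NeZero L], 2 ≤ L → ∀ β : ℝ, 0 ≤ β →
      ∀ (g : GaugeConfig d L (Matrix.specialUnitaryGroup (Fin n) ℂ) → ℝ), Measurable g →
        ∀ C : ℝ, (∀ U, 0 < g U) → (∀ U, g U ≤ C) →
          essM (wilsonMeasure (d := d) (L := L) (StrongCoupling.defRep n) β)
              ((Measure.pi fun _ : Edge d L =>
                  haarProbability (Matrix.specialUnitaryGroup (Fin n) ℂ)).withDensity
                fun U => ENNReal.ofReal (g U)) ≤
            C * Real.exp (-(c / 2 * Fintype.card (Plaquette d L) * Real.log (1 + β ^ 2))) := by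
  obtain ⟨c, hc, h⟩ := wilson_klDiv_haar_ge_log (d := d) (n := n) hn hd
  refine ⟨c, hc, fun L _ hL β hβ g hg C hg0 hgC => ?_⟩
  have hρ : Continuous (StrongCoupling.defRep n) := continuous_subtype_val
  have htr : ∀ x : Matrix.specialUnitaryGroup (Fin n) ℂ, ((StrongCoupling.defRep n) x).trace.re ≤ n :=
    fun x => by
      have h := Literature.RepresentationTheory.CompactGroups.CompactGroup.abs_re_trace_le_card
        (StrongCoupling.defRep n) hρ x
      rw [Fintype.card_fin] at h
      exact (abs_le.1 h).2
  have h1 := Theory2.Lattice.wilson_essM_le (d := d) (L := L) (StrongCoupling.defRep n) hρ htr hβ hg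
    hg0 hgC
  refine h1.trans ?_
  have hC : 0 ≤ C := (hg0 (fun _ => 1)).le.trans (hgC _)
  refine mul_le_mul_of_nonneg_left (Real.exp_le_exp.2 (neg_le_neg ?_)) hC
  have h2 := h L hL β hβ
  simpa only [trivialMeasure] using h2

end SUN

end Summit.Ventures.LatticeQCDFlow.TrivializingMaps

end
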